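import Literature.LinearAlgebra.Matrix.GerstenhaberNilpotentSubspaceEqualityProof

/-!
# `GrenetZeon.DualUnipotentThreeHalves` (stmt-ValiantsHypothesis-24318), R2 heavy-top instrument — GERSTENHABER EQUALITY WITH A
# REGULAR NILPOTENT INSIDE: a nilpotent space of dimension `C(m,2)` containing the shift `J_m` IS `𝔫_m` (Q1-PROOF Level 1 (L1.b)(ii))

Experiment cell «val-heavytop-census» (D-0160), engine seat val-htc-eng-2 g3 (kernel-only lane; P-Q1 bricks, director-valiant R336 (5)).
Step (L1.b)(ii) of the lead's pencil proof `lead-g2/Q1-PROOF.md` (Q1 «ι(7) ≤ 19»; crux copy `CENSUS-Q1-PROOF.md`), and a recurring step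
of the cell's census arguments (ROADMAP-codim1, NOTE-iota5/6: «Gerstenhaber equality + `J ∈ V⁰` ⇒ `V⁰ = 𝔫`»): by the case of equality
in Gerstenhaber's theorem (✓ `Literature…deSeguinsPazzis2013_equality_holds`) a nilpotent space `V ≤ M_m(ℂ)` of dimension `C(m,2)`
is `P⁻¹ 𝔫_m P`; if moreover the standard shift `J = Σ_i E_{i,i+1}` lies in `V`, then `P` preserves the standard flag (the only
complete flag stable under `J`), so `V = 𝔫_m` on the nose:

* `isUpper_inv_of_shift_conj` — if `P J P⁻¹` is strictly upper triangular (`P` invertible) then `P⁻¹` is upper triangular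
  (column induction: `J P⁻¹ = P⁻¹ N`, and row `i−1` of `J P⁻¹` is row `i` of `P⁻¹`);
* ★ `isStrictUpper_of_mem_of_shift_mem` — `V` nilpotent, `finrank V = C(m,2)`, `J ∈ V` ⇒ every member of `V` is strictly upper
  triangular; `mem_iff_isStrictUpper_of_shift_mem` — indeed `A ∈ V ↔ IsStrictUpper A`.

Honest framing: a lemma for the instrument's kernel ports (P-Q1 Level 1; Thm C / census strata); nothing here proves or refutes
`HeavyTopLaw`/`HeavyTopSlowLaw`, 24318, S3 or 8062; `VP ≠ VNP` is NOT proved.  No definitions.  [folklore; Q1-PROOF (L1.b); this seat]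
-/

noncomputable section

-- single-conjunct layout: Sub = Summit, duplicated namespace component intended
set_option linter.dupNamespace false

namespace Summit.ValiantsHypothesis.ValiantsHypothesis.Theorems.GrenetZeon.HeavyTopStrictUpperOfJordan

open Matrix
open Literature.LinearAlgebra.Matrix (IsStrictUpper IsUpper)
open Literature.LinearAlgebra.Matrix.GerstenhaberNilpotentSubspace (deSeguinsPazzis2013_equality_holds
  finrank_eq_choose_two_of_forall_mem_iff)

/-- Left multiplication by the shift `J = Σ_i E_{i,i+1}` moves row `i+1` to row `i`. -/
theorem shift_mul_apply {m : ℕ} (M : Matrix (Fin m) (Fin m) ℂ) (i k : Fin m) (hi : i.val + 1 < m) :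
    ((Matrix.of fun a b : Fin m => if b.val = a.val + 1 then (1 : ℂ) else 0) * M) i k = M ⟨i.val + 1, hi⟩ k := by
  rw [Matrix.mul_apply, Finset.sum_eq_single ⟨i.val + 1, hi⟩]
  · simp
  · intro j _ hj
    have : ¬ (j.val = i.val + 1) := fun e => hj (Fin.ext e)
    simp [this]
  · intro h; exact absurd (Finset.mem_univ _) h

/-- **The shift has only the standard flag.**  If `P` is invertible and `P J P⁻¹` is strictly upper triangular, then `P⁻¹` is
upper triangular. [folklore] -/
theorem isUpper_inv_of_shift_conj {m : ℕ} (P : Matrix (Fin m) (Fin m) ℂ) (hP : IsUnit P.det)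
    (hN : IsStrictUpper (P * (Matrix.of fun a b : Fin m => if b.val = a.val + 1 then (1 : ℂ) else 0) * P⁻¹)) :
    IsUpper P⁻¹ := by
  set J : Matrix (Fin m) (Fin m) ℂ := Matrix.of fun a b : Fin m => if b.val = a.val + 1 then (1 : ℂ) else 0 with hJ
  set N := P * J * P⁻¹ with hNdef
  have hJQ : J * P⁻¹ = P⁻¹ * N := by
    rw [hNdef, ← Matrix.mul_assoc, ← Matrix.mul_assoc, Matrix.nonsing_inv_mul _ hP, Matrix.one_mul]
  -- column induction
  have key : ∀ (k : ℕ) (i kf : Fin m), kf.val = k → kf < i → P⁻¹ i kf = 0 := by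
    intro k
    induction k using Nat.strong_induction_on with
    | _ k ih =>
      intro i kf hkf hki
      have hki' : kf.val < i.val := hki
      have hi' : i.val - 1 + 1 < m := by have := i.isLt; omega
      have e1 : (J * P⁻¹) ⟨i.val - 1, by omega⟩ kf = P⁻¹ i kf := by
        rw [hJ, shift_mul_apply _ _ _ hi']
        have hidx : (⟨i.val - 1 + 1, hi'⟩ : Fin m) = i := Fin.ext (show i.val - 1 + 1 = i.val by omega)
        rw [hidx]
      have e2 : (P⁻¹ * N) ⟨i.val - 1, by omega⟩ kf = 0 := by
        rw [Matrix.mul_apply]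
        refine Finset.sum_eq_zero fun j _ => ?_
        by_cases hjk : kf ≤ j
        · rw [hN j kf hjk, mul_zero]
        · have hjk' : j.val < kf.val := lt_of_not_ge hjk
          rw [ih j.val (by omega) ⟨i.val - 1, by omega⟩ j rfl (Fin.lt_def.2 (show j.val < i.val - 1 by omega)), zero_mul]
      rw [← e1, hJQ, e2]
  intro i j hij
  exact key j.val i j rfl hij

/-- ★ **Gerstenhaber equality with the shift inside.**  If every member of `V ≤ M_m(ℂ)` is nilpotent, `finrank V = C(m,2)` and the
shift `J = Σ_i E_{i,i+1} ∈ V`, then every member of `V` is strictly upper triangular. [folklore; Q1-PROOF (L1.b)(ii), via ✓ dSP13 equality] -/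
theorem isStrictUpper_of_mem_of_shift_mem {m : ℕ} (V : Submodule ℂ (Matrix (Fin m) (Fin m) ℂ)) (hV : ∀ A ∈ V, IsNilpotent A)
    (hdim : Module.finrank ℂ V = m.choose 2)
    (hJ : (Matrix.of fun a b : Fin m => if b.val = a.val + 1 then (1 : ℂ) else 0) ∈ V) :
    ∀ A ∈ V, IsStrictUpper A := by
  classical
  obtain ⟨P, hP, hPV⟩ := deSeguinsPazzis2013_equality_holds ℂ m V hV hdim
  have hPdet : IsUnit P.det := (Matrix.isUnit_iff_isUnit_det P).1 hP
  have hQup : IsUpper P⁻¹ := isUpper_inv_of_shift_conj P hPdet ((hPV _).1 hJ)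
  have hPup : IsUpper P := by
    haveI := Matrix.invertibleOfIsUnitDet P⁻¹ (Matrix.isUnit_nonsing_inv_det P hPdet)
    have h := Matrix.blockTriangular_inv_of_blockTriangular hQup
    rwa [Matrix.nonsing_inv_nonsing_inv P hPdet] at h
  intro A hA
  have hS : IsStrictUpper (P * A * P⁻¹) := (hPV A).1 hA
  have hA' : A = P⁻¹ * (P * A * P⁻¹) * P := by
    rw [← Matrix.mul_assoc, ← Matrix.mul_assoc, Matrix.nonsing_inv_mul P hPdet, Matrix.one_mul, Matrix.mul_assoc,
      Matrix.nonsing_inv_mul P hPdet, Matrix.mul_one]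
  rw [hA']
  set S := P * A * P⁻¹ with hSdef
  intro i j hij
  rw [Matrix.mul_apply]
  refine Finset.sum_eq_zero fun b _ => ?_
  by_cases hbj : j < b
  · rw [hPup hbj, mul_zero]
  · have hbi : b ≤ i := le_trans (le_of_not_gt hbj) hij
    have h0 : (P⁻¹ * S) i b = 0 := by
      rw [Matrix.mul_apply]
      refine Finset.sum_eq_zero fun a _ => ?_
      by_cases hai : a < i
      · rw [hQup hai, zero_mul]
      · rw [hS a b (le_trans hbi (le_of_not_gt hai)), mul_zero]
    rw [h0, zero_mul]

/-- **Corollary**: under the same hypotheses `V` IS the space of strictly upper triangular matrices: `A ∈ V ↔ IsStrictUpper A`. -/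
theorem mem_iff_isStrictUpper_of_shift_mem {m : ℕ} (V : Submodule ℂ (Matrix (Fin m) (Fin m) ℂ)) (hV : ∀ A ∈ V, IsNilpotent A)
    (hdim : Module.finrank ℂ V = m.choose 2)
    (hJ : (Matrix.of fun a b : Fin m => if b.val = a.val + 1 then (1 : ℂ) else 0) ∈ V) :
    ∀ A, A ∈ V ↔ IsStrictUpper A := by
  classical
  -- the submodule of strictly upper triangular matrices
  obtain ⟨NT, hNT⟩ : ∃ NT : Submodule ℂ (Matrix (Fin m) (Fin m) ℂ), ∀ A, A ∈ NT ↔ IsStrictUpper A :=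
    ⟨{ carrier := {A | IsStrictUpper A}
       zero_mem' := fun _ _ _ => rfl
       add_mem' := fun ha hb => ha.add hb
       smul_mem' := fun c A hA i j hij => by
         show (c • A) i j = 0
         rw [Matrix.smul_apply, hA i j hij, smul_zero] }, fun A => Iff.rfl⟩
  have hle : V ≤ NT := fun A hA => (hNT A).2 (isStrictUpper_of_mem_of_shift_mem V hV hdim hJ A hA)
  have hfin : Module.finrank ℂ NT = m.choose 2 := finrank_eq_choose_two_of_forall_mem_iff NT hNT
  haveI : FiniteDimensional ℂ NT := FiniteDimensional.finiteDimensional_submodule NT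
  have heq : V = NT := Submodule.eq_of_le_of_finrank_eq hle (by rw [hdim, hfin])
  intro A
  rw [heq, hNT]

end Summit.ValiantsHypothesis.ValiantsHypothesis.Theorems.GrenetZeon.HeavyTopStrictUpperOfJordan

end
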